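import Summits.QuantumFields.YangMills.Theorems.ConvexGribovBodyCovarianceBoundDefs
import Summits.QuantumFields.YangMills.Theorems.BrascampLiebVacuumSC.Negative.PlaquetteVarianceFloor

/-!
# Stub `stub_plaquetteFloor` of the line `SketchIdeator1` for the crux `BrascampLiebVacuumSC`
# (stmt-QuantumFields-16404, route `ConvexGribovBody`)

A volume-uniform floor for the time-zero spatial plaquette energies under Wilson's measure: for a
compact simple `G`, a faithful continuous unitary lattice representation `r` and every coupling
`β` there is `a = a(G, r, β) > 0` such that on EVERY torus `(2S+1)⁴`, `S ≥ 1`, every time-zero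
spatial plaquette `p` (base site `(0, y)`, directions `j + 1 < k + 1`) has

`E_μ[N − Re tr ρ(U_p)] ≥ a`, `μ = wilson4 r β S`.

The proof is the one-link freeing argument of `Negative/PlaquetteVarianceFloor.lean`
(`plaquette_variance_floor`), run for the non-negative observable `f(U) = N − Re tr ρ(U_p)`
instead of the squared fluctuation:

* one-link Haar floor (`PlaquetteFloor.exists_haar_dev_le`): `a₀ := ∫ (N − Re tr ρ(g)) dg > 0`
  (the integrand is continuous, `≥ 0` by unitarity and positive at some `g` since `G` is
  non-trivial and `r` faithful; Haar measure charges open sets), and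
  `∫ (N − Re tr ρ(V g)) dg = a₀` for every `V` (left invariance);
* write `dμ = Z⁻¹ e^{−βS} dU`, free the first link `l = ((0,y), j+1)` of `p` against the
  Boltzmann comparison `e^{±|β|B}` (`exists_wilsonAction_update_bound`: `|S(U) − S(U[l ↦ g])| ≤ B`
  uniformly in the volume), integrate `l` first (Mathlib's iterated marginals `lmarginal` over the
  product Haar measure): `U_p[l ↦ g] = g · V` with `V` independent of `g`, so the inner integral is
  `a₀`; the two comparison factors and `Z` cancel and `a := e^{−|β|B} e^{−|β|B} a₀` works.

Elementary; no named facts are used. Helper lemmas live in the sub-namespace `PlaquetteFloor`.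
-/

set_option autoImplicit false

open scoped BigOperators Topology Matrix
open Filter MeasureTheory ProbabilityTheory
open Literature.MathematicalPhysics.QuantumFieldTheory
open Summit.QuantumFields.YangMills.Cruxes.CovarianceBound.SupportWindow
  (froSq coulombF IsCoulMin gluon modeCov supCov wilson4)

noncomputable section

namespace Summit.QuantumFields.YangMills.Theorems.BrascampLiebVacuumSC

open scoped ENNReal
open Summit.QuantumFields.YangMills.Theorems.BrascampLiebVacuum.Negative
open Summit.QuantumFields.YangMills.Theorems.BrascampLiebVacuumSC.Negative

namespace PlaquetteFloor

/-! ### One-link Haar floor for the plaquette energy -/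

/-- `Re tr ρ(g) ≤ N` for a unitary lattice representation. [folklore] -/
theorem re_trace_le {G : Type*} [Group G] [TopologicalSpace G] (r : LatticeRep G) (g : G) :
    (r.ρ g).trace.re ≤ r.N := by
  by_cases h : r.ρ g = 1
  · rw [h, Matrix.trace_one, Fintype.card_fin, Complex.natCast_re]
  · exact (re_trace_lt_of_ne_one (r.mem_unitary g) h).le

/-- **Uniform one-link energy floor**: for a faithful unitary `r` of a compact simple `G` there is
`a₀ > 0` with `a₀ ≤ ∫ (N − Re tr ρ(V g)) dg` for every `V` (in fact equality: left invariance of the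
Haar measure; positivity because the continuous non-negative integrand is positive somewhere,
`G` being non-trivial and `r` faithful, and Haar measure charges open sets). [folklore] -/
theorem exists_haar_dev_le {G : Type*} [Group G] [TopologicalSpace G] [IsTopologicalGroup G]
    [CompactSpace G] [MeasurableSpace G] [BorelSpace G] (hG : IsCompactSimpleLieGroup G)
    (r : LatticeRep G) :
    ∃ a₀ : ℝ, 0 < a₀ ∧ ∀ V : G,
      a₀ ≤ ∫ g, ((r.N : ℝ) - (r.ρ (V * g)).trace.re) ∂haarProbability G := by
  set χ : G → ℝ := fun g => (r.N : ℝ) - (r.ρ g).trace.re with hχ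
  have hχc : Continuous χ := continuous_const.sub (continuous_trace_re r.ρ r.continuous)
  have hχ0 : ∀ g, 0 ≤ χ g := fun g => sub_nonneg.2 (re_trace_le r g)
  refine ⟨∫ g, χ g ∂haarProbability G, ?_, fun V => ?_⟩
  · obtain ⟨a, ha⟩ := exists_re_trace_lt hG r
    have hint : Integrable χ (haarProbability G) :=
      hχc.integrable_of_hasCompactSupport (HasCompactSupport.of_compactSpace _)
    rw [integral_pos_iff_support_of_nonneg hχ0 hint]
    refine hχc.isOpen_support.measure_pos _ ⟨a, ?_⟩
    rw [Function.mem_support]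
    exact (sub_pos.2 ha).ne'
  · exact (integral_mul_left_eq_self (fun g => χ g) V).ge

end PlaquetteFloor

open PlaquetteFloor

/-- **Stub (MEASURE THEORY — plaquette floor).** For compact simple `G`, faithful `r` and every `β` there is
`a = a(G,r,β) > 0` such that on every torus `(2S+1)⁴` with `S ≥ 1` every time-zero spatial plaquette has
`E_μ[N − Re tr ρ(U_p)] ≥ a` (free the first link of `p`: the tilt density is `≥ e^{−|β|B}` with `B` the
one-link oscillation of the Wilson action, and `∫ (N − Re tr ρ(g V)) dHaar(g) = ∫ (N − Re tr ρ) dHaar > 0`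
for non-trivial `G`). [folklore] -/
theorem stub_plaquetteFloor :
    ∀ (G : Type) [Group G] [TopologicalSpace G] [IsTopologicalGroup G] [CompactSpace G]
    [MeasurableSpace G] [BorelSpace G], IsCompactSimpleLieGroup G →
    ∀ (r : LatticeRep G) (β : ℝ), ∃ a : ℝ, 0 < a ∧ ∀ S : ℕ, 1 ≤ S →
    ∀ (y : Fin 3 → ZMod (2 * S + 1)) (j k : Fin 3), j < k →
      a ≤ ∫ U, ((r.N : ℝ) - (r.ρ (plaquetteHolonomy U (Fin.cons (0 : ZMod (2 * S + 1)) y)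
        j.succ k.succ)).trace.re) ∂(wilson4 r β S) := by
  intro G _ _ _ _ _ _ hG r β
  classical
  obtain ⟨σ, hσ, hσle⟩ := exists_haar_dev_le hG r
  obtain ⟨B, hB0, hB⟩ := exists_wilsonAction_update_bound r
  set e : ℝ := Real.exp (-(|β| * B)) with he
  have he0 : 0 < e := Real.exp_pos _
  refine ⟨e * e * σ, by positivity, fun S hS y j k hjk => ?_⟩
  haveI : Fact (1 < 2 * S + 1) := ⟨by omega⟩
  haveI : SecondCountableTopology G :=
    (r.continuous.isClosedEmbedding r.injective).isEmbedding.secondCountableTopology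
  -- the plaquette: base site `x₀`, directions `i ≠ i'`
  set x₀ : Site 4 (2 * S + 1) := Fin.cons (0 : ZMod (2 * S + 1)) y with hx₀
  set i : Fin 4 := j.succ with hi
  set i' : Fin 4 := k.succ with hi'
  have hii' : i ≠ i' := by
    rw [hi, hi']
    exact fun h => hjk.ne (Fin.succ_injective _ h)
  show e * e * σ ≤ ∫ U, ((r.N : ℝ) - (r.ρ (plaquetteHolonomy U x₀ i i')).trace.re)
    ∂(wilsonMeasure (d := 4) (L := 2 * S + 1) r.ρ β)
  set μ := wilsonMeasure (d := 4) (L := 2 * S + 1) r.ρ β with hμ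
  haveI hprob : IsProbabilityMeasure μ :=
    isProbabilityMeasure_wilsonMeasure (d := 4) (L := 2 * S + 1) r.ρ r.continuous β
  set f : GaugeConfig 4 (2 * S + 1) G → ℝ := fun U =>
    (r.N : ℝ) - (r.ρ (plaquetteHolonomy U x₀ i i')).trace.re with hf
  show e * e * σ ≤ ∫ U, f U ∂μ
  set π : Measure (GaugeConfig 4 (2 * S + 1) G) := Measure.pi fun _ => haarProbability G with hπ
  set w : GaugeConfig 4 (2 * S + 1) G → ℝ := fun U => Real.exp (-β * wilsonAction r.ρ U) with hw
  set l : Edge 4 (2 * S + 1) := (x₀, i) with hl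
  set w₁ : GaugeConfig 4 (2 * S + 1) G → ℝ := fun U => w (Function.update U l 1) with hw₁
  -- continuity / measurability / signs
  have hfc : Continuous f := continuous_const.sub (continuous_re_trace_plaquette r x₀ i i')
  have hfm : Measurable f := hfc.measurable
  have hf0 : ∀ U, 0 ≤ f U := fun U => sub_nonneg.2 (re_trace_le r _)
  have hwm : Measurable w := ((measurable_wilsonAction r.ρ r.continuous).const_mul _).exp
  have hw₁m : Measurable w₁ := hwm.comp measurable_update_left
  -- Boltzmann comparisons in both directions
  have hcmp1 : ∀ U, e * w₁ U ≤ w U := fun U =>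
    exp_mul_le_of_abs_sub_le (hB (2 * S + 1) U l 1)
  have hcmp2 : ∀ U, e * w U ≤ w₁ U := fun U => by
    have h := hB (2 * S + 1) U l 1
    rw [abs_sub_comm] at h
    exact exp_mul_le_of_abs_sub_le h
  -- the partition function
  set Z : ℝ≥0∞ := partitionFunction (d := 4) (L := 2 * S + 1) r.ρ β with hZ
  have hZeq : Z = ∫⁻ U, ENNReal.ofReal (w U) ∂π := by
    simp only [hZ, partitionFunction, wilsonWeight, withDensity_apply _ MeasurableSet.univ,
      Measure.restrict_univ, hπ, hw]
  have hZ1 : Z⁻¹ * Z = 1 := by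
    have h1 : μ Set.univ = 1 := measure_univ
    rw [hμ, wilsonMeasure, Measure.smul_apply, smul_eq_mul] at h1
    exact h1
  -- the expectation as a lintegral against product Haar measure
  have hμπ : μ = Z⁻¹ • π.withDensity (fun U => ENNReal.ofReal (w U)) := by
    simp only [hμ, wilsonMeasure, wilsonWeight, hZ, hπ, hw]
  have hvar : ∫ U, f U ∂μ = (∫⁻ U, ENNReal.ofReal (f U) ∂μ).toReal :=
    integral_eq_lintegral_of_nonneg_ae (Eventually.of_forall hf0) hfm.aestronglyMeasurable
  have hlin : ∫⁻ U, ENNReal.ofReal (f U) ∂μ =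
      Z⁻¹ * ∫⁻ U, ENNReal.ofReal (w U) * ENNReal.ofReal (f U) ∂π := by
    rw [hμπ, lintegral_smul_measure, lintegral_withDensity_eq_lintegral_mul _
      hwm.ennreal_ofReal hfm.ennreal_ofReal]
    rfl
  -- finiteness
  obtain ⟨M, -, hM⟩ := exists_bound_trace_re_nonneg r.ρ r.continuous
  have hfb : ∀ U, f U ≤ (r.N : ℝ) + M := fun U => by
    have h1 := (abs_le.1 (hM (plaquetteHolonomy U x₀ i i'))).1
    simp only [hf]
    linarith
  have hfin : ∫⁻ U, ENNReal.ofReal (f U) ∂μ ≠ ⊤ := by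
    refine ne_top_of_le_ne_top (b := ∫⁻ _U, ENNReal.ofReal ((r.N : ℝ) + M) ∂μ) ?_ ?_
    · rw [lintegral_const, measure_univ, mul_one]; exact ENNReal.ofReal_ne_top
    · exact lintegral_mono fun U => ENNReal.ofReal_le_ofReal (hfb U)
  -- MAIN CHAIN (product Haar): ∫ w f ≥ e · (e · Z · σ)
  have hstep1 : ENNReal.ofReal e * ∫⁻ U, ENNReal.ofReal (w₁ U) * ENNReal.ofReal (f U) ∂π ≤
      ∫⁻ U, ENNReal.ofReal (w U) * ENNReal.ofReal (f U) ∂π := by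
    rw [← lintegral_const_mul' _ _ ENNReal.ofReal_ne_top]
    refine lintegral_mono fun U => ?_
    rw [← mul_assoc, ← ENNReal.ofReal_mul he0.le]
    exact mul_le_mul_left (ENNReal.ofReal_le_ofReal (hcmp1 U)) _
  -- one-link marginal
  have hkey : ∀ x : GaugeConfig 4 (2 * S + 1) G,
      ENNReal.ofReal (w₁ x) * ENNReal.ofReal σ ≤
        ∫⁻ g, ENNReal.ofReal (w₁ (Function.update x l g)) *
          ENNReal.ofReal (f (Function.update x l g)) ∂haarProbability G := by
    intro x
    have hw₁u : ∀ g, w₁ (Function.update x l g) = w₁ x := fun g => by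
      simp only [hw₁, Function.update_idem]
    simp_rw [hw₁u]
    rw [lintegral_const_mul' _ _ ENNReal.ofReal_ne_top]
    refine mul_le_mul_right ?_ _
    -- the one-link integral of `f`
    set Vx : G := x (Site.shift x₀ i, i') * (x (Site.shift x₀ i', i))⁻¹ * (x (x₀, i'))⁻¹ with hVx
    have hfu : ∀ g, f (Function.update x l g) = (r.N : ℝ) - (r.ρ (Vx * g)).trace.re := by
      intro g
      have h2 : ((Site.shift x₀ i, i') : Edge 4 (2 * S + 1)) ≠ l := by
        simp [hl, Prod.ext_iff, hii'.symm]
      have h3 : ((Site.shift x₀ i', i) : Edge 4 (2 * S + 1)) ≠ l := by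
        intro h
        have := congrArg (fun e : Edge 4 (2 * S + 1) => e.1 i') h
        simp [Site.shift, hl] at this
      have h4 : ((x₀, i') : Edge 4 (2 * S + 1)) ≠ l := by
        simp [hl, Prod.ext_iff, hii'.symm]
      have hhol : plaquetteHolonomy (Function.update x l g) x₀ i i' = g * Vx := by
        simp only [plaquetteHolonomy, hVx, hl]
        rw [Function.update_self, Function.update_of_ne h2, Function.update_of_ne h3,
          Function.update_of_ne h4]
        simp only [mul_assoc]
      simp only [hf, hhol, map_mul]
      rw [Matrix.trace_mul_comm]
    simp_rw [hfu]
    have hcont : Continuous fun g : G => (r.N : ℝ) - (r.ρ (Vx * g)).trace.re :=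
      continuous_const.sub
        ((continuous_trace_re r.ρ r.continuous).comp (continuous_const.mul continuous_id))
    rw [← ofReal_integral_eq_lintegral_ofReal
      (hcont.integrable_of_hasCompactSupport (HasCompactSupport.of_compactSpace _))
      (Eventually.of_forall fun g => sub_nonneg.2 (re_trace_le r _))]
    exact ENNReal.ofReal_le_ofReal (hσle Vx)
  have hstep2 : ∫⁻ U, ENNReal.ofReal (w₁ U) * ENNReal.ofReal σ ∂π ≤
      ∫⁻ U, ENNReal.ofReal (w₁ U) * ENNReal.ofReal (f U) ∂π := by
    have hΦm : Measurable fun U => ENNReal.ofReal (w₁ U) * ENNReal.ofReal (f U) :=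
      hw₁m.ennreal_ofReal.mul hfm.ennreal_ofReal
    have hΨm : Measurable fun U => ENNReal.ofReal (w₁ U) * ENNReal.ofReal σ :=
      hw₁m.ennreal_ofReal.mul measurable_const
    rw [hπ, lintegral_eq_lmarginal_univ (1 : GaugeConfig 4 (2 * S + 1) G),
      lintegral_eq_lmarginal_univ (1 : GaugeConfig 4 (2 * S + 1) G),
      ← Finset.sdiff_union_of_subset (Finset.subset_univ {l}),
      lmarginal_union _ _ hΨm Finset.sdiff_disjoint, lmarginal_union _ _ hΦm Finset.sdiff_disjoint]
    refine lmarginal_mono (fun x => ?_) _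
    rw [lmarginal_singleton, lmarginal_singleton]
    have hw₁u : ∀ g, w₁ (Function.update x l g) = w₁ x := fun g => by
      simp only [hw₁, Function.update_idem]
    calc ∫⁻ g, ENNReal.ofReal (w₁ (Function.update x l g)) * ENNReal.ofReal σ ∂haarProbability G
        = ENNReal.ofReal (w₁ x) * ENNReal.ofReal σ := by
          simp_rw [hw₁u]; rw [lintegral_const, measure_univ, mul_one]
      _ ≤ _ := hkey x
  have hstep3 : ENNReal.ofReal e * Z ≤ ∫⁻ U, ENNReal.ofReal (w₁ U) ∂π := by
    rw [hZeq, ← lintegral_const_mul' _ _ ENNReal.ofReal_ne_top]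
    refine lintegral_mono fun U => ?_
    rw [← ENNReal.ofReal_mul he0.le]
    exact ENNReal.ofReal_le_ofReal (hcmp2 U)
  -- assemble in ℝ≥0∞
  have hchain : ENNReal.ofReal e * (ENNReal.ofReal e * Z * ENNReal.ofReal σ) ≤
      ∫⁻ U, ENNReal.ofReal (w U) * ENNReal.ofReal (f U) ∂π := by
    refine le_trans ?_ hstep1
    refine mul_le_mul_right ?_ _
    refine le_trans ?_ hstep2
    rw [lintegral_mul_const' _ _ ENNReal.ofReal_ne_top]
    exact mul_le_mul_left hstep3 _
  have hgoal : ENNReal.ofReal (e * e * σ) ≤ ∫⁻ U, ENNReal.ofReal (f U) ∂μ := by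
    rw [hlin]
    calc ENNReal.ofReal (e * e * σ)
        = Z⁻¹ * (ENNReal.ofReal e * (ENNReal.ofReal e * Z * ENNReal.ofReal σ)) := by
          rw [ENNReal.ofReal_mul (by positivity), ENNReal.ofReal_mul he0.le]
          calc ENNReal.ofReal e * ENNReal.ofReal e * ENNReal.ofReal σ
              = (Z⁻¹ * Z) * (ENNReal.ofReal e * ENNReal.ofReal e * ENNReal.ofReal σ) := by
                rw [hZ1, one_mul]
            _ = _ := by ring
      _ ≤ _ := mul_le_mul_right hchain _
  rw [hvar]
  exact (ENNReal.ofReal_le_iff_le_toReal hfin).1 hgoal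

end Summit.QuantumFields.YangMills.Theorems.BrascampLiebVacuumSC

end
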